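import Literature.Analysis.FluidPDE.FluidComputer.ShellTransferIdentities

/-!
# Parseval for the shell-to-shell transfer: the physical-space definition `-⟨u_K·(u·∇)u_Q⟩` equals the Fourier-side `shellTransfer`

HONEST FRAMING (cell `pub-fluidc`, verbatim): *low prior, high value-of-information experiment on
Tao's machine paradigm; NOT a claim that NS blows up.* Companion to `ShellTransferIdentities`
(the G2-0 identities) — it closes the one link that file left open: the cell's solvers and
scorer DEFINE the transfer in physical space, `𝒯(Q→K) = -⟨u_K · (u·∇) u_Q⟩`
[cite: AlexakisMininniPouquet2005ShellToShellMHD, §II] (volume average over the `(2π)³` cell),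
and compute it spectrally; here the two are proved EQUAL for every truncated field.

Setting: `û : ℤ³ → ℂ³` real and incompressible (`ShellTransfer.FourierVelocity`), vanishing off a
finite mode set `S` (a Galerkin / dealiased pseudo-spectral field); the physical fields are the
trigonometric polynomials `u_{S,j}(x) = Σ_{k∈S} û_j(k) e^{ik·x}` (`field`), their coordinate
derivatives `∂_l u_{S,j} = Σ i k_l û_j(k) e^{ik·x}` (`dfield`, PROVED to be the derivatives:
`hasDerivAt_field_x/y/z`), and the cell integral is the iterated interval integral over
`[0,2π]³` (`cellIntegralC`, as in `ClassicalLatticeData` but complex-valued).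

* `modeIntegral_eq`, `cellIntegralC_wave_eq`: orthogonality `∫∫∫ e^{im·x} = (2π)³ [m = 0]`;
* `advIntegrand_expand`: `u_K·(u_S·∇)u_Q = Σ_{k∈K,p∈S,q∈Q} i (q·û(p)) (û(k)·û(q)) e^{i(k+p+q)·x}`;
* `cellIntegralC_advIntegrand`: its cell integral is `(2π)³ Σ` over the CLOSED triads `k+p+q = 0`;
* **`transferPhys_eq_shellTransfer`**: for `û` supported in `S` and a receiving shell `K` closed
  under `k ↦ -k` (every `{a ≤ |k| < b}` is),
  `-⟨u_K·(u_S·∇)u_Q⟩ = shellTransfer û K Q = Σ_{k∈K} Σ_{q∈Q} Im[(k·û(k-q))(conj û(k)·û(q))]`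
  — the `T^{uu}_{nm}` of [cite: Verma2004MHDTurbulencePhysRep, §3.2]; the proof is the printed
  one: orthogonality kills the open triads, reality turns `û(-k)` into `conj û(k)`, and
  incompressibility of the mediator turns `q·û(p)` into `k·û(p)`.

Consequently every identity of `ShellTransferIdentities` (antisymmetry, detailed conservation,
flux identity) holds for the physical-space transfer of any truncated real incompressible field.
What is NOT here: infinite Fourier series / `L²(𝕋³)` (only finite mode sets), time dependence.
No named facts (D-0026).
-/

noncomputable section

namespace Literature.Analysis.FluidPDE.FluidComputer

open Complex ComplexConjugate Finset Real intervalIntegral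
open scoped BigOperators

namespace ShellTransfer


/-! ## Plane waves and their cell integrals -/

/-- `J(n) = ∫₀^{2π} e^{i n t} dt`. [folklore] -/
def modeIntegral (n : ℤ) : ℂ := ∫ t in (0:ℝ)..2 * π, cexp (I * (n : ℂ) * (t : ℂ))

/-- `∫₀^{2π} e^{i n t} dt = 2π` for `n = 0` and `0` otherwise. [folklore] -/
theorem modeIntegral_eq (n : ℤ) : modeIntegral n = if n = 0 then (2 * π : ℂ) else 0 := by
  unfold modeIntegral
  split_ifs with h
  · subst h
    simp
  · have hc : (I * (n : ℂ)) ≠ 0 := mul_ne_zero I_ne_zero (by exact_mod_cast h)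
    have e : (fun t : ℝ => cexp (I * (n : ℂ) * (t : ℂ))) = fun t : ℝ => cexp ((I * (n : ℂ)) * (t : ℂ)) := by
      funext t; ring_nf
    rw [e, integral_exp_mul_complex hc]
    have h1 : cexp (I * (n : ℂ) * ((2 * π : ℝ) : ℂ)) = 1 := by
      have := Complex.exp_int_mul_two_pi_mul_I n
      rw [← this]; congr 1; push_cast; ring
    have h0 : cexp (I * (n : ℂ) * ((0 : ℝ) : ℂ)) = 1 := by simp
    rw [h1, h0]; simp

/-- The 1D Fourier mode `e_n(t) = e^{i n t}` as a function of a real variable. [folklore] -/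
def mode (n : ℤ) (t : ℝ) : ℂ := cexp (I * (n : ℂ) * (t : ℂ))

/-- `e_{m+n} = e_m e_n`. [folklore] -/
theorem mode_add (m n : ℤ) (t : ℝ) : mode (m + n) t = mode m t * mode n t := by
  unfold mode
  rw [← Complex.exp_add]
  congr 1; push_cast; ring

/-- `e_0 = 1`. [folklore] -/
theorem mode_zero (t : ℝ) : mode 0 t = 1 := by
  unfold mode; simp

/-- `e_n` is continuous. [folklore] -/
theorem continuous_mode (n : ℤ) : Continuous (mode n) := by
  unfold mode; fun_prop

/-- `d/dt e_n(t) = i n e_n(t)`. [folklore] -/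
theorem hasDerivAt_mode (n : ℤ) (t : ℝ) : HasDerivAt (mode n) (I * (n : ℂ) * mode n t) t := by
  unfold mode
  have h1 : HasDerivAt (fun s : ℝ => I * (n : ℂ) * (s : ℂ)) (I * (n : ℂ) * 1) t :=
    ((hasDerivAt_id t).ofReal_comp).const_mul (I * (n : ℂ))
  have h2 := h1.cexp
  convert h2 using 1
  ring

/-- The plane wave `e^{i m·x} = e_{m₀}(x) e_{m₁}(y) e_{m₂}(z)` on the period cell. [folklore] -/
def wave (m : Fin 3 → ℤ) (x y z : ℝ) : ℂ := mode (m 0) x * mode (m 1) y * mode (m 2) z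

/-- `e^{i(m+n)·x} = e^{i m·x} e^{i n·x}`. [folklore] -/
theorem wave_add (m n : Fin 3 → ℤ) (x y z : ℝ) : wave (m + n) x y z = wave m x y z * wave n x y z := by
  unfold wave
  simp only [Pi.add_apply, mode_add]
  ring

/-- Iterated integral of a complex-valued function over the period cell `[0,2π]³`
(`x` outermost, `z` innermost). [folklore] -/
def cellIntegralC (f : ℝ → ℝ → ℝ → ℂ) : ℂ :=
  ∫ x in (0:ℝ)..2 * π, ∫ y in (0:ℝ)..2 * π, ∫ z in (0:ℝ)..2 * π, f x y z

/-- `modeIntegral n = ∫₀^{2π} e_n`. [folklore] -/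
theorem modeIntegral_def (n : ℤ) : modeIntegral n = ∫ t in (0:ℝ)..2 * π, mode n t := rfl

/-- **Orthogonality of plane waves on the cell**: `∫∫∫ e^{i m·x} = J(m₀) J(m₁) J(m₂)`. [folklore] -/
theorem cellIntegralC_wave (m : Fin 3 → ℤ) (c : ℂ) :
    cellIntegralC (fun x y z => c * wave m x y z) =
      c * (modeIntegral (m 0) * modeIntegral (m 1) * modeIntegral (m 2)) := by
  unfold cellIntegralC wave
  have hz : ∀ x y : ℝ, (∫ z in (0:ℝ)..2 * π, c * (mode (m 0) x * mode (m 1) y * mode (m 2) z)) =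
      c * mode (m 0) x * mode (m 1) y * modeIntegral (m 2) := by
    intro x y
    rw [modeIntegral_def, ← intervalIntegral.integral_const_mul]
    congr 1; funext z; ring
  have hy : ∀ x : ℝ, (∫ y in (0:ℝ)..2 * π, ∫ z in (0:ℝ)..2 * π,
      c * (mode (m 0) x * mode (m 1) y * mode (m 2) z)) =
      c * mode (m 0) x * modeIntegral (m 1) * modeIntegral (m 2) := by
    intro x
    simp_rw [hz]
    rw [intervalIntegral.integral_mul_const, modeIntegral_def (m 1),
      ← intervalIntegral.integral_const_mul]
  simp_rw [hy]
  rw [intervalIntegral.integral_mul_const, intervalIntegral.integral_mul_const,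
    intervalIntegral.integral_const_mul, modeIntegral_def (m 0)]
  ring

/-- `∫∫∫ c e^{i m·x} = (2π)³ c` if `m = 0`, and `0` otherwise. [folklore] -/
theorem cellIntegralC_wave_eq (m : Fin 3 → ℤ) (c : ℂ) :
    cellIntegralC (fun x y z => c * wave m x y z) = if m = 0 then c * (2 * π : ℂ) ^ 3 else 0 := by
  rw [cellIntegralC_wave, modeIntegral_eq, modeIntegral_eq, modeIntegral_eq]
  by_cases h : m = 0
  · subst h
    simp only [Pi.zero_apply, if_true]
    ring
  · have h' : ¬ (m 0 = 0 ∧ m 1 = 0 ∧ m 2 = 0) := by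
      intro hh
      apply h
      funext i
      fin_cases i
      · exact hh.1
      · exact hh.2.1
      · exact hh.2.2
    rw [if_neg h]
    by_cases h0 : m 0 = 0
    · by_cases h1 : m 1 = 0
      · have h2 : m 2 ≠ 0 := fun h2 => h' ⟨h0, h1, h2⟩
        simp [h2]
      · simp [h1]
    · simp [h0]

/-! ## Trigonometric-polynomial velocity fields and their coordinate derivatives -/

variable (U : FourierVelocity)

/-- Component `j` of the (complex-valued representation of the) velocity field carried by the
modes in `S`: `u_{S,j}(x) = Σ_{k∈S} û_j(k) e^{i k·x}`. [folklore] -/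
def field (S : Finset (Fin 3 → ℤ)) (j : Fin 3) (x y z : ℝ) : ℂ :=
  ∑ k ∈ S, U.coeff k j * wave k x y z

/-- Its derivative along coordinate `l`: `∂_l u_{S,j}(x) = Σ_{q∈S} i q_l û_j(q) e^{i q·x}`. [folklore] -/
def dfield (S : Finset (Fin 3 → ℤ)) (l j : Fin 3) (x y z : ℝ) : ℂ :=
  ∑ q ∈ S, I * ((q l : ℤ) : ℂ) * U.coeff q j * wave q x y z

/-- `dfield … 0 j` IS the `x`-derivative of `field … j`. [folklore] -/
theorem hasDerivAt_field_x (S : Finset (Fin 3 → ℤ)) (j : Fin 3) (x y z : ℝ) :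
    HasDerivAt (fun s => field U S j s y z) (dfield U S 0 j x y z) x := by
  unfold field dfield wave
  apply HasDerivAt.fun_sum
  intro q _
  have h := (((hasDerivAt_mode (q 0) x).mul_const (mode (q 1) y)).mul_const (mode (q 2) z)).const_mul
    (U.coeff q j)
  exact h.congr_deriv (by ring)

/-- `dfield … 1 j` IS the `y`-derivative of `field … j`. [folklore] -/
theorem hasDerivAt_field_y (S : Finset (Fin 3 → ℤ)) (j : Fin 3) (x y z : ℝ) :
    HasDerivAt (fun s => field U S j x s z) (dfield U S 1 j x y z) y := by
  unfold field dfield wave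
  apply HasDerivAt.fun_sum
  intro q _
  have h := (((hasDerivAt_mode (q 1) y).const_mul (mode (q 0) x)).mul_const (mode (q 2) z)).const_mul
    (U.coeff q j)
  exact h.congr_deriv (by ring)

/-- `dfield … 2 j` IS the `z`-derivative of `field … j`. [folklore] -/
theorem hasDerivAt_field_z (S : Finset (Fin 3 → ℤ)) (j : Fin 3) (x y z : ℝ) :
    HasDerivAt (fun s => field U S j x y s) (dfield U S 2 j x y z) z := by
  unfold field dfield wave
  apply HasDerivAt.fun_sum
  intro q _
  have h := ((hasDerivAt_mode (q 2) z).const_mul (mode (q 0) x * mode (q 1) y)).const_mul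
    (U.coeff q j)
  exact h.congr_deriv (by ring)

/-! ## The physical-space shell-to-shell transfer and its Fourier expansion -/

/-- The integrand `u_K · (u_S·∇) u_Q = Σ_j u_{K,j} Σ_l u_{S,l} ∂_l u_{Q,j}`. [folklore] -/
def advIntegrand (S K Q : Finset (Fin 3 → ℤ)) (x y z : ℝ) : ℂ :=
  ∑ j, field U K j x y z * ∑ l, field U S l x y z * dfield U Q l j x y z

/-- **Physical-space shell-to-shell transfer** `𝒯(Q→K) = -⟨u_K · (u·∇) u_Q⟩`, `⟨·⟩` the volume
average over the `(2π)³` cell (the definition of [cite: AlexakisMininniPouquet2005ShellToShellMHD, §II]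
with the cell-average normalisation of the cell's solvers; `u = u_S` the full truncated field). -/
def transferPhys (S K Q : Finset (Fin 3 → ℤ)) : ℝ :=
  -((cellIntegralC (advIntegrand U S K Q)).re / (2 * π) ^ 3)

/-- Triad coefficient `C(k,p,q) = i (q·û(p)) (û(k)·û(q))`. [folklore] -/
def triadCoeff (k p q : Fin 3 → ℤ) : ℂ := I * kdot q (U.coeff p) * cdot (U.coeff k) (U.coeff q)

/-- Inner expansion: `Σ_l u_{S,l} ∂_l u_{Q,j} = Σ_{p∈S} Σ_{q∈Q} i (q·û(p)) û_j(q) e^{i(p+q)·x}`. [folklore] -/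
theorem adv_expand (S Q : Finset (Fin 3 → ℤ)) (j : Fin 3) (x y z : ℝ) :
    ∑ l, field U S l x y z * dfield U Q l j x y z =
      ∑ p ∈ S, ∑ q ∈ Q, I * kdot q (U.coeff p) * U.coeff q j * wave (p + q) x y z := by
  unfold field dfield kdot
  -- LHS = Σ_l Σ_p Σ_q ( … ), RHS = Σ_p Σ_q Σ_l ( … )
  simp only [Finset.sum_mul, Finset.mul_sum]
  -- LHS order (l, q, p), RHS order (p, q, l): bring both to (q, p, l)
  rw [Finset.sum_comm (s := (Finset.univ : Finset (Fin 3))) (t := Q),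
    Finset.sum_comm (s := S) (t := Q)]
  refine Finset.sum_congr rfl fun q _ => ?_
  rw [Finset.sum_comm (s := (Finset.univ : Finset (Fin 3))) (t := S)]
  refine Finset.sum_congr rfl fun p _ => ?_
  refine Finset.sum_congr rfl fun l _ => ?_
  rw [wave_add]; ring

/-- Full expansion: `u_K·(u_S·∇)u_Q = Σ_{k∈K} Σ_{p∈S} Σ_{q∈Q} C(k,p,q) e^{i(k+p+q)·x}`. [folklore] -/
theorem advIntegrand_expand (S K Q : Finset (Fin 3 → ℤ)) (x y z : ℝ) :
    advIntegrand U S K Q x y z =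
      ∑ k ∈ K, ∑ p ∈ S, ∑ q ∈ Q, triadCoeff U k p q * wave (k + p + q) x y z := by
  unfold advIntegrand triadCoeff cdot
  simp_rw [adv_expand]
  unfold field
  -- LHS = Σ_j Σ_k Σ_p Σ_q ( … ), RHS = Σ_k Σ_p Σ_q Σ_j ( … )
  simp only [Finset.sum_mul, Finset.mul_sum]
  -- LHS order (j, p, q, k), RHS order (k, p, q, j): bring both to (p, q, k, j)
  rw [Finset.sum_comm (s := (Finset.univ : Finset (Fin 3))) (t := S),
    Finset.sum_comm (s := K) (t := S)]
  refine Finset.sum_congr rfl fun p _ => ?_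
  rw [Finset.sum_comm (s := (Finset.univ : Finset (Fin 3))) (t := Q),
    Finset.sum_comm (s := K) (t := Q)]
  refine Finset.sum_congr rfl fun q _ => ?_
  rw [Finset.sum_comm (s := (Finset.univ : Finset (Fin 3))) (t := K)]
  refine Finset.sum_congr rfl fun k _ => ?_
  refine Finset.sum_congr rfl fun j _ => ?_
  rw [add_assoc, wave_add k (p + q)]; ring

/-! ## Evaluating the cell integral of a finite sum of plane waves -/

/-- `J(m₀)J(m₁)J(m₂) = (2π)³` if `m = 0` and `0` otherwise. [folklore] -/
theorem modeIntegral_prod_eq (m : Fin 3 → ℤ) :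
    modeIntegral (m 0) * modeIntegral (m 1) * modeIntegral (m 2) = if m = 0 then (2 * π : ℂ) ^ 3 else 0 := by
  have h := cellIntegralC_wave_eq m 1
  rw [cellIntegralC_wave, one_mul, one_mul] at h
  exact h

/-- Linearity + orthogonality: `∫∫∫ Σ_t c_t e^{i m_t·x} = Σ_t c_t J(m_t,0) J(m_t,1) J(m_t,2)`. [folklore] -/
theorem cellIntegralC_sum_wave {α : Type*} (T : Finset α) (c : α → ℂ) (m : α → Fin 3 → ℤ) :
    cellIntegralC (fun x y z => ∑ t ∈ T, c t * wave (m t) x y z) =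
      ∑ t ∈ T, c t * (modeIntegral (m t 0) * modeIntegral (m t 1) * modeIntegral (m t 2)) := by
  unfold cellIntegralC wave
  have hz : ∀ x y : ℝ, (∫ z in (0:ℝ)..2 * π, ∑ t ∈ T, c t * (mode (m t 0) x * mode (m t 1) y * mode (m t 2) z)) =
      ∑ t ∈ T, (c t * mode (m t 0) x * modeIntegral (m t 2)) * mode (m t 1) y := by
    intro x y
    rw [intervalIntegral.integral_finsetSum]
    · refine Finset.sum_congr rfl fun t _ => ?_
      rw [modeIntegral_def, ← intervalIntegral.integral_const_mul, ← intervalIntegral.integral_mul_const]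
      congr 1; funext z; ring
    · intro t _
      exact (continuous_const.mul (continuous_const.mul (continuous_mode _))).intervalIntegrable _ _
  have hy : ∀ x : ℝ, (∫ y in (0:ℝ)..2 * π, ∫ z in (0:ℝ)..2 * π,
      ∑ t ∈ T, c t * (mode (m t 0) x * mode (m t 1) y * mode (m t 2) z)) =
      ∑ t ∈ T, (c t * modeIntegral (m t 2) * modeIntegral (m t 1)) * mode (m t 0) x := by
    intro x
    simp_rw [hz]
    rw [intervalIntegral.integral_finsetSum]
    · refine Finset.sum_congr rfl fun t _ => ?_
      rw [intervalIntegral.integral_const_mul, modeIntegral_def (m t 1)]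
      ring
    · intro t _
      exact (continuous_const.mul (continuous_mode _)).intervalIntegrable _ _
  simp_rw [hy]
  rw [intervalIntegral.integral_finsetSum]
  · refine Finset.sum_congr rfl fun t _ => ?_
    rw [intervalIntegral.integral_const_mul, modeIntegral_def (m t 0)]
    ring
  · intro t _
    exact (continuous_const.mul (continuous_mode _)).intervalIntegrable _ _

/-- The expansion of the integrand as ONE finite sum over triads `(k,p,q) ∈ K × S × Q`. [folklore] -/
theorem advIntegrand_expand' (S K Q : Finset (Fin 3 → ℤ)) :
    advIntegrand U S K Q = fun x y z =>
      ∑ t ∈ K ×ˢ (S ×ˢ Q), triadCoeff U t.1 t.2.1 t.2.2 * wave (t.1 + t.2.1 + t.2.2) x y z := by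
  funext x y z
  rw [advIntegrand_expand, Finset.sum_product]
  refine Finset.sum_congr rfl fun k _ => ?_
  rw [Finset.sum_product]

/-- **The cell integral of `u_K·(u_S·∇)u_Q` is `(2π)³ Σ` of the triad coefficients over the
CLOSED triads `k + p + q = 0`.** [folklore] -/
theorem cellIntegralC_advIntegrand (S K Q : Finset (Fin 3 → ℤ)) :
    cellIntegralC (advIntegrand U S K Q) =
      ∑ k ∈ K, ∑ p ∈ S, ∑ q ∈ Q, (if k + p + q = 0 then triadCoeff U k p q * (2 * π : ℂ) ^ 3 else 0) := by
  rw [advIntegrand_expand', cellIntegralC_sum_wave, Finset.sum_product]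
  refine Finset.sum_congr rfl fun k _ => ?_
  rw [Finset.sum_product]
  refine Finset.sum_congr rfl fun p _ => ?_
  refine Finset.sum_congr rfl fun q _ => ?_
  simp only
  rw [modeIntegral_prod_eq]
  split_ifs <;> simp

/-! ## Collapsing the closed-triad sum and reindexing: Parseval for the transfer -/

/-- Coefficients vanishing off `S` make the triad coefficient vanish when the mediator is outside `S`. [folklore] -/
theorem triadCoeff_eq_zero_of_not_mem (S : Finset (Fin 3 → ℤ)) (hS : ∀ p, p ∉ S → U.coeff p = 0)
    (k p q : Fin 3 → ℤ) (hp : p ∉ S) : triadCoeff U k p q = 0 := by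
  unfold triadCoeff kdot
  rw [hS p hp]
  simp

/-- The `p`-sum over closed triads collapses to the single mediator `p = -(k+q)`. [folklore] -/
theorem sum_closedTriad (S : Finset (Fin 3 → ℤ)) (hS : ∀ p, p ∉ S → U.coeff p = 0)
    (k q : Fin 3 → ℤ) (X : ℂ) :
    ∑ p ∈ S, (if k + p + q = 0 then triadCoeff U k p q * X else 0) = triadCoeff U k (-(k + q)) q * X := by
  have hcond : ∀ p : Fin 3 → ℤ, (k + p + q = 0) ↔ (-(k + q) = p) := by
    intro p; constructor
    · intro h
      have : p = -(k + q) := by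
        rw [eq_neg_iff_add_eq_zero, ← h]; abel
      exact this.symm
    · intro h; rw [← h]; abel
  simp_rw [hcond]
  rw [Finset.sum_ite_eq]
  split_ifs with hmem
  · rfl
  · rw [triadCoeff_eq_zero_of_not_mem U S hS k _ q hmem, zero_mul]

/-- On a CLOSED triad the coefficient is `i · [(k'·û(k'-q)) (conj û(k') · û(q))]` with `k' = -k`
(reality for `û(-k')`, incompressibility of the mediator for `q·û = k'·û`). [folklore] -/
theorem triadCoeff_closed (k q : Fin 3 → ℤ) :
    triadCoeff U (-k) (k - q) q =
      I * (kdot k (U.coeff (k - q)) * cdot (fun i => (starRingEnd ℂ) (U.coeff k i)) (U.coeff q)) := by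
  unfold triadCoeff
  have hreal : U.coeff (-k) = fun i => (starRingEnd ℂ) (U.coeff k i) := funext fun i => U.reality k i
  rw [hreal, ← kdot_mediator U k q]
  ring

/-- **Parseval for the shell-to-shell transfer.** For a truncated field (coefficients vanishing
off the finite mode set `S`) and a receiving shell `K` closed under `k ↦ -k` (as every shell
`{k : a ≤ |k| < b}` is), the PHYSICAL-SPACE transfer `-⟨u_K · (u_S·∇) u_Q⟩` EQUALS the Fourier-side
`shellTransfer û K Q = Σ_{k∈K} Σ_{q∈Q} Im[(k·û(k-q))(conj û(k)·û(q))]`.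
[cite: AlexakisMininniPouquet2005ShellToShellMHD, §II] / [cite: Verma2004MHDTurbulencePhysRep, §3.2] -/
theorem transferPhys_eq_shellTransfer (S K Q : Finset (Fin 3 → ℤ))
    (hS : ∀ p, p ∉ S → U.coeff p = 0) (hK : ∀ k ∈ K, -k ∈ K) :
    transferPhys U S K Q = shellTransfer U K Q := by
  unfold transferPhys shellTransfer modeTransfer
  rw [cellIntegralC_advIntegrand]
  have hswap : ∑ k ∈ K, ∑ p ∈ S, ∑ q ∈ Q,
      (if k + p + q = 0 then triadCoeff U k p q * (2 * π : ℂ) ^ 3 else 0) =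
      ∑ k ∈ K, ∑ q ∈ Q, triadCoeff U k (-(k + q)) q * (2 * π : ℂ) ^ 3 := by
    refine Finset.sum_congr rfl fun k _ => ?_
    rw [Finset.sum_comm]
    refine Finset.sum_congr rfl fun q _ => ?_
    exact sum_closedTriad U S hS k q _
  rw [hswap]
  -- reindex k ↦ -k in the receiving shell
  have hreidx : ∑ k ∈ K, ∑ q ∈ Q, triadCoeff U k (-(k + q)) q * (2 * π : ℂ) ^ 3 =
      ∑ k ∈ K, ∑ q ∈ Q, triadCoeff U (-k) (k - q) q * (2 * π : ℂ) ^ 3 := by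
    refine Finset.sum_equiv (Equiv.neg (Fin 3 → ℤ)) (fun k => ?_) (fun k hk => ?_)
    · constructor
      · intro hk; exact hK k hk
      · intro hk; have := hK (-k) hk; simpa using this
    · refine Finset.sum_congr rfl fun q _ => ?_
      simp only [Equiv.neg_apply, neg_neg]
      congr 2
      abel
  rw [hreidx]
  simp_rw [triadCoeff_closed]
  -- real part and normalisation
  have hpi : ((2 * π : ℂ) ^ 3) = (((2 * π) ^ 3 : ℝ) : ℂ) := by push_cast; ring
  have hterm : ∀ Z : ℂ, (I * Z * (2 * π : ℂ) ^ 3).re = -(Z.im * (2 * π) ^ 3) := by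
    intro Z
    rw [hpi, Complex.mul_re, Complex.ofReal_re, Complex.ofReal_im, mul_zero, sub_zero,
      Complex.mul_re, Complex.I_re, Complex.I_im, zero_mul, one_mul, zero_sub, neg_mul]
  simp_rw [Complex.re_sum, hterm, Finset.sum_neg_distrib, neg_div, neg_neg, Finset.sum_div]
  refine Finset.sum_congr rfl fun k _ => Finset.sum_congr rfl fun q _ => ?_
  have hpos : ((2 * π) ^ 3 : ℝ) ≠ 0 := by positivity
  field_simp

end ShellTransfer

end Literature.Analysis.FluidPDE.FluidComputer

end
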